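import Literature.Computability.AlgebraicComplexity.WaringRankTrCube
import Mathlib.LinearAlgebra.Matrix.Notation
import Mathlib.LinearAlgebra.Matrix.Trace
import Mathlib.LinearAlgebra.Dimension.Constructions
import Mathlib.LinearAlgebra.Dimension.OrzechProperty
import Mathlib.Algebra.QuadraticDiscriminant
import Mathlib.FieldTheory.IsAlgClosed.Basic
import Mathlib.Analysis.Complex.Polynomial.Basic
import Mathlib.Tactic.NoncommRing
import HarnessLib

/-!
# Discharge of `CHILO2018_waringRank_two`: the Waring rank of `tr(A³)` on `M₂(ℂ)` is `6`
# (Chiantini–Hauenstein–Ikenmeyer–Landsberg–Ottaviani 2018, Thm. 1.3(1))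

Topic `Literature/Computability/AlgebraicComplexity`. This sibling file of `WaringRankTrCube.lean`
PROVES the named fact

* `CHILO2018_waringRank_two_holds : CHILO2018_waringRank_two` — `waringRankTrCube 2 = 6`,
  i.e. `R_S(sM⟨2⟩) = 6` [CHILO2018, Thm. 1.3(1): "`R_S(sM⟨2⟩) = 6` ([Seg], [LT])"].

On `M₂(ℂ)`, `sM⟨2⟩(A) = tr(A³) = a₀₀³ + 3 a₀₀a₀₁a₁₀ + 3 a₀₁a₁₀a₁₁ + a₁₁³ = tr(A)·(tr(A)² − 3 det A)`
[CHILO2018, §2.1, (2.1)], a reducible cubic in `4` variables.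

## Content

* `trCube_two_waringDecomposition` (upper bound `≤ 6`) — the minimal decomposition printed in
  [CHILO2018, §2.1, (2.2)]: `tr(A³) = ∑_{i=1}^{6} tr(Lᵢ A)³` with
  `L₁ = ½[[-1,1],[-1,-1]]`, `L₂ = ½[[-1,-1],[1,-1]]`, `L₃ = ½[[1,1],[1,1]]`,
  `L₄ = ½[[1,-1],[-1,1]]`, `L₅ = E₀₀`, `L₆ = E₁₁`, checked by `ring`. (The paper pairs `L` with
  `A` by `tr(Lᵀ A)`; the definition `waringRankTrCube` pairs by `tr(L A)`. Transposition swaps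
  `L₁ ↔ L₂` and fixes the symmetric `L₃, …, L₆`, so the same six matrices serve.)
* `six_le_of_waringDecomposition_trCube_two` (lower bound `≥ 6`) — EVERY identity
  `tr(A³) = ∑_{i<r} tr(Lᵢ A)³` on `M₂(ℂ)` has `r ≥ 6`. This is Landsberg–Teitler's singular-locus
  bound [LT2010, Thm. 1.3 with `s = 1`, packaged as Cor. 6.8: a concise reducible cubic in `n = 4`
  variables has rank `≥ 2n − 2 = 6`], which is the `[LT]` of CHILO2018's citation. We give the
  elementary specialisation of the printed proof of [LT2010, Thm. 1.3] to this cubic: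
  1. polarisation of the identity (values at `A + H`, `A − H`, `H`) gives
     `tr(A²H) = ∑ᵢ tr(LᵢA)² tr(LᵢH)`, i.e. `A² = ∑ᵢ tr(LᵢA)² Lᵢ` (trace form non-degenerate);
  2. hence every square, and so every matrix (`E₀₀ = E₀₀²`, `E₁₁ = E₁₁²`,
     `E₀₀ + E₀₁ = (E₀₀ + E₀₁)²`, `E₁₀ + E₁₁ = (E₁₀ + E₁₁)²`), lies in `span{Lᵢ}` — the cubic is
     concise, `⟨φ⟩ = W = M₂(ℂ)`, `dim W = 4`;
  3. a nilpotent `P` (`P² = 0`: exactly the singular points of `{tr(A³) = 0}`, [CHILO2018,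
     Prop. 2.2(i)]) yields the linear relation `∑ᵢ tr(LᵢP)² Lᵢ = 0`;
  4. with `P₀ = E₀₁` some coefficient `tr(LⱼP₀)² ≠ 0` (else `P₀ ⊥ span{Lᵢ} = W`), so the `Lᵢ`,
     `i ≠ j`, still span `W`: `r − 1 ≥ 4`; and if `r ≤ 5` they form a basis;
  5. since `ℂ` is algebraically closed there is a NON-ZERO nilpotent `P₁ = [[u,u²],[−1,−u]]` with
     `tr(LⱼP₁) = 0` (a quadratic equation for `u` with leading coefficient `(Lⱼ)₁₀ = tr(LⱼP₀) ≠ 0`)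
     — "the singular locus, a conic, meets the hyperplane `{tr(Lⱼ ·) = 0}`";
  6. the relation at `P₁` and the independence of `(Lᵢ)_{i≠j}` force `tr(LᵢP₁) = 0` for all `i`,
     so `P₁ ⊥ W`, `P₁ = 0`: contradiction. Hence `r ≥ 6`.
* `CHILO2018_waringRank_two_holds` — `le_antisymm` of the two bounds (`sInf` over a set
  containing `6` all of whose elements are `≥ 6`).

## Not here

The border rank `bR_S(sM⟨2⟩) = 5` of the same Thm. 1.3(1), and the general statement of
[LT2010, Thm. 1.3 / Cor. 6.8] (projective dimension theory), are not formalised.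

## References

* [CHILO2018] L. Chiantini, J. D. Hauenstein, C. Ikenmeyer, J. M. Landsberg, G. Ottaviani,
  *Polynomials and the exponent of matrix multiplication*, Bull. LMS 50 (2018) 369–389,
  doi:10.1112/blms.12147, arXiv:1706.05074 (held: `arxiv-1706.05074`, chunks p. 4–6): Thm. 1.3(1)
  (p. 4), Prop. 2.2(i) and §2.1 with (2.1), (2.2) (p. 5–6).
  Bib key `ChiantiniHauensteinIkenmeyerLandsbergOttaviani2018`.
* [LT2010] J. M. Landsberg, Z. Teitler, *On the ranks and border ranks of symmetric tensors*,
  Found. Comput. Math. 10 (2010) 339–366, doi:10.1007/s10208-009-9055-3, arXiv:0901.0487 (held: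
  `arxiv-0901.0487`, chunks p. 3, 11, 13): Thm. 1.3, Lemma 6.4, Cor. 6.8, Prop. 7.2, Rem. 7.3
  ("`x(y₁² + y₂² + y₃²)` has rank exactly `6`"). Bib key `LandsbergTeitler2010`.
-/

noncomputable section

open scoped BigOperators

namespace Literature.Computability.AlgebraicComplexity

/-! ## Upper bound: the printed six-term decomposition -/

/-- **The minimal Waring decomposition of `tr(A³)` on `M₂(ℂ)`** (Chiantini et al. 2018, §2.1,
(2.2)): `tr(A³) = ∑_{i=1}^{6} tr(Lᵢ A)³` with `L₁ = ½[[-1,1],[-1,-1]]`, `L₂ = ½[[-1,-1],[1,-1]]`,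
`L₃ = ½[[1,1],[1,1]]`, `L₄ = ½[[1,-1],[-1,1]]`, `L₅ = E₀₀`, `L₆ = E₁₁` (as linear forms in
`A = [[a,b],[c,d]]`: `a³ + d³ + 3bc(a+d) = a³ + d³ + ⅛[(t+b+c)³ + (t−b−c)³ − (t+b−c)³ − (t−b+c)³]`,
`t = a + d`). [cite: ChiantiniHauensteinIkenmeyerLandsbergOttaviani2018, §2.1 (2.2)] -/
theorem trCube_two_waringDecomposition :
    ∃ (L : Fin 6 → Matrix (Fin 2) (Fin 2) ℂ), ∀ A : Matrix (Fin 2) (Fin 2) ℂ,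
      (A ^ 3).trace = ∑ i, ((L i * A).trace) ^ 3 := by
  refine ⟨![!![-1/2, 1/2; -1/2, -1/2], !![-1/2, -1/2; 1/2, -1/2], !![1/2, 1/2; 1/2, 1/2],
    !![1/2, -1/2; -1/2, 1/2], !![1, 0; 0, 0], !![0, 0; 0, 1]], fun A => ?_⟩
  rw [Matrix.eta_fin_two A]
  simp [Fin.sum_univ_succ, pow_succ, Matrix.trace_fin_two]
  ring

/-- `R_S(sM⟨2⟩) ≤ 6` (Chiantini et al. 2018, §2.1, from the decomposition (2.2)).
[cite: ChiantiniHauensteinIkenmeyerLandsbergOttaviani2018, §2.1 (2.2)] -/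
theorem waringRankTrCube_two_le : waringRankTrCube 2 ≤ 6 := by
  obtain ⟨L, hL⟩ := trCube_two_waringDecomposition
  exact waringRankTrCube_le L hL

/-! ## Lower bound: the Landsberg–Teitler singular-locus argument for `tr(A³)` on `M₂(ℂ)` -/

/-- **Lower bound `R_S(sM⟨2⟩) ≥ 6`**: every identity `tr(A³) = ∑_{i<r} tr(Lᵢ A)³` on `M₂(ℂ)` has
`r ≥ 6` (Landsberg–Teitler 2010, Cor. 6.8 — a concise reducible cubic in `n = 4` variables has
Waring rank `≥ 2n − 2` — here `tr(A³) = tr(A)(tr(A)² − 3 det A)`; proved by the elementary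
`s = 1` case of the proof of their Thm. 1.3: polarise to `A² = ∑ᵢ tr(LᵢA)² Lᵢ`, deduce that the
`Lᵢ` span `M₂(ℂ)`, and evaluate at a non-zero nilpotent `P` (a singular point of the cubic
surface) chosen on the hyperplane `tr(Lⱼ ·) = 0` of a redundant `Lⱼ`; see the module docstring).
[cite: LandsbergTeitler2010, Cor. 6.8 (via Thm. 1.3)] -/
theorem six_le_of_waringDecomposition_trCube_two {r : ℕ} (L : Fin r → Matrix (Fin 2) (Fin 2) ℂ)
    (h : ∀ A : Matrix (Fin 2) (Fin 2) ℂ, (A ^ 3).trace = ∑ i, ((L i * A).trace) ^ 3) :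
    6 ≤ r := by
  -- Step 1: polarisation `tr(A² H) = ∑ᵢ tr(Lᵢ A)² tr(Lᵢ H)`.
  have hpol : ∀ A H : Matrix (Fin 2) (Fin 2) ℂ,
      (A * A * H).trace = ∑ i, ((L i * A).trace) ^ 2 * (L i * H).trace := by
    intro A H
    have key : ((A + H) ^ 3).trace - ((A - H) ^ 3).trace - ((H ^ 3).trace + (H ^ 3).trace)
        = 6 * (A * A * H).trace := by
      have e : (A + H) ^ 3 - (A - H) ^ 3 - (H ^ 3 + H ^ 3)
          = (A * A * H + A * H * A + H * A * A) + (A * A * H + A * H * A + H * A * A) := by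
        noncomm_ring
      apply_fun Matrix.trace at e
      simp only [Matrix.trace_sub, Matrix.trace_add] at e
      rw [Matrix.trace_mul_cycle H A A, Matrix.trace_mul_cycle A H A] at e
      rw [e]
      ring
    have e2 : ((A + H) ^ 3).trace - ((A - H) ^ 3).trace - ((H ^ 3).trace + (H ^ 3).trace)
        = 6 * ∑ i, ((L i * A).trace) ^ 2 * (L i * H).trace := by
      rw [h (A + H), h (A - H), h H, ← Finset.sum_add_distrib, ← Finset.sum_sub_distrib,
        ← Finset.sum_sub_distrib, Finset.mul_sum]
      refine Finset.sum_congr rfl fun i _ => ?_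
      simp only [Matrix.mul_add, Matrix.mul_sub, Matrix.trace_add, Matrix.trace_sub]
      ring
    exact mul_left_cancel₀ (by norm_num : (6 : ℂ) ≠ 0) (key.symm.trans e2)
  -- Step 1': `A² = ∑ᵢ tr(Lᵢ A)² • Lᵢ` (the trace pairing is non-degenerate).
  have hsq : ∀ A : Matrix (Fin 2) (Fin 2) ℂ, A * A = ∑ i, ((L i * A).trace) ^ 2 • L i := by
    intro A
    refine Matrix.ext_iff_trace_mul_right.mpr fun H => ?_
    rw [hpol A H, Finset.sum_mul, Matrix.trace_sum]
    refine Finset.sum_congr rfl fun i _ => ?_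
    rw [Matrix.smul_mul, Matrix.trace_smul, smul_eq_mul]
  -- Step 2: the `Lᵢ` span `M₂(ℂ)` (every matrix is a combination of squares).
  have hsqmem : ∀ A : Matrix (Fin 2) (Fin 2) ℂ, A * A ∈ Submodule.span ℂ (Set.range L) := by
    intro A
    rw [hsq A]
    exact Submodule.sum_mem _ fun i _ =>
      Submodule.smul_mem _ _ (Submodule.subset_span ⟨i, rfl⟩)
  have htop : ∀ X : Matrix (Fin 2) (Fin 2) ℂ, X ∈ Submodule.span ℂ (Set.range L) := by
    intro X
    have e : X = (X 0 0 - X 0 1) • ((!![1, 0; 0, 0] : Matrix (Fin 2) (Fin 2) ℂ) * !![1, 0; 0, 0])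
        + X 0 1 • ((!![1, 1; 0, 0] : Matrix (Fin 2) (Fin 2) ℂ) * !![1, 1; 0, 0])
        + X 1 0 • ((!![0, 0; 1, 1] : Matrix (Fin 2) (Fin 2) ℂ) * !![0, 0; 1, 1])
        + (X 1 1 - X 1 0) • ((!![0, 0; 0, 1] : Matrix (Fin 2) (Fin 2) ℂ) * !![0, 0; 0, 1]) := by
      ext i j
      fin_cases i <;> fin_cases j <;> simp
    rw [e]
    exact Submodule.add_mem _ (Submodule.add_mem _ (Submodule.add_mem _
      (Submodule.smul_mem _ _ (hsqmem _)) (Submodule.smul_mem _ _ (hsqmem _)))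
      (Submodule.smul_mem _ _ (hsqmem _))) (Submodule.smul_mem _ _ (hsqmem _))
  have hStop : Submodule.span ℂ (Set.range L) = ⊤ := Submodule.eq_top_iff'.mpr htop
  -- Step 3: only `0` is trace-orthogonal to all the `Lᵢ`.
  have hperp : ∀ P : Matrix (Fin 2) (Fin 2) ℂ, (∀ i, (L i * P).trace = 0) → P = 0 := by
    intro P hP
    have hall : ∀ X : Matrix (Fin 2) (Fin 2) ℂ, (X * P).trace = 0 := by
      intro X
      induction htop X using Submodule.span_induction with
      | mem x hx => obtain ⟨i, rfl⟩ := hx; exact hP i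
      | zero => simp
      | add x y _ _ hx hy => simp [Matrix.add_mul, Matrix.trace_add, hx, hy]
      | smul a x _ hx => simp [Matrix.trace_smul, hx]
    refine Matrix.ext_iff_trace_mul_left.mpr fun X => ?_
    rw [hall, Matrix.mul_zero, Matrix.trace_zero]
  -- Step 4: the nilpotent `P₀ = E₀₁`; some coefficient `tr(Lⱼ P₀)` is non-zero.
  obtain ⟨j, hj⟩ : ∃ j, (L j * !![0, 1; 0, 0]).trace ≠ 0 := by
    by_contra! hcon
    have h0 := hperp _ hcon
    have h01 := congrFun (congrFun h0 0) 1
    simp at h01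
  have hLjP0 : (L j * !![0, 1; 0, 0]).trace = L j 1 0 := by
    rw [Matrix.eta_fin_two (L j)]
    simp [Matrix.trace_fin_two]
  have hP0sq : (!![0, 1; 0, 0] : Matrix (Fin 2) (Fin 2) ℂ) * !![0, 1; 0, 0] = 0 := by
    ext i j
    fin_cases i <;> fin_cases j <;> simp
  have hrel0 : ∑ i, ((L i * !![0, 1; 0, 0]).trace) ^ 2 • L i = 0 := by
    rw [← hsq, hP0sq]
  -- Step 5: dropping the index `j` still leaves a spanning family `L'`.
  set L' : {i : Fin r // i ≠ j} → Matrix (Fin 2) (Fin 2) ℂ := fun i => L i with hL'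
  have hLj : L j ∈ Submodule.span ℂ (Set.range L') := by
    have e1 : ∑ i ∈ Finset.univ.erase j, ((L i * !![0, 1; 0, 0]).trace) ^ 2 • L i
        = -(((L j * !![0, 1; 0, 0]).trace) ^ 2 • L j) := by
      rw [Finset.sum_erase_eq_sub (Finset.mem_univ j), hrel0, zero_sub]
    have e2 : L j = (((L j * !![0, 1; 0, 0]).trace) ^ 2)⁻¹ •
        -(∑ i ∈ Finset.univ.erase j, ((L i * !![0, 1; 0, 0]).trace) ^ 2 • L i) := by
      rw [e1, neg_neg, smul_smul, inv_mul_cancel₀ (pow_ne_zero 2 hj), one_smul]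
    rw [e2]
    refine Submodule.smul_mem _ _ (Submodule.neg_mem _ (Submodule.sum_mem _ fun i hi => ?_))
    exact Submodule.smul_mem _ _ (Submodule.subset_span ⟨⟨i, Finset.ne_of_mem_erase hi⟩, rfl⟩)
  have hspan' : ⊤ ≤ Submodule.span ℂ (Set.range L') := by
    rw [← hStop]
    refine Submodule.span_le.mpr ?_
    rintro _ ⟨i, rfl⟩
    by_cases hij : i = j
    · rw [hij]; exact hLj
    · exact Submodule.subset_span ⟨⟨i, hij⟩, rfl⟩
  -- Step 6: counting — `r - 1 ≥ dim M₂(ℂ) = 4`; if moreover `r ≤ 5`, `L'` is a basis.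
  have hfin : Module.finrank ℂ (Matrix (Fin 2) (Fin 2) ℂ) = 4 := by
    simp [Module.finrank_matrix]
  have hcard : Fintype.card {i : Fin r // i ≠ j} = r - 1 := by simp
  have h4 : 4 ≤ r - 1 := by
    have h1 : (Set.range L').finrank ℂ ≤ Fintype.card {i : Fin r // i ≠ j} :=
      finrank_range_le_card L'
    have h2 : (Set.range L').finrank ℂ = 4 := by
      rw [Set.finrank, eq_top_iff.mpr hspan', finrank_top, hfin]
    omega
  by_contra hr
  have hcard4 :
      Fintype.card {i : Fin r // i ≠ j} = Module.finrank ℂ (Matrix (Fin 2) (Fin 2) ℂ) := by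
    rw [hcard, hfin]
    omega
  have hli : LinearIndependent ℂ L' :=
    linearIndependent_of_top_le_span_of_card_eq_finrank hspan' hcard4
  -- Step 7: a non-zero nilpotent `P₁` on the hyperplane `tr(Lⱼ ·) = 0` (`ℂ` algebraically closed).
  have hr' : L j 1 0 ≠ 0 := by rwa [hLjP0] at hj
  obtain ⟨u, hu⟩ : ∃ u : ℂ,
      L j 1 0 * (u * u) + (L j 0 0 - L j 1 1) * u + (-L j 0 1) = 0 :=
    exists_quadratic_eq_zero hr' (IsAlgClosed.exists_eq_mul_self _)
  set P₁ : Matrix (Fin 2) (Fin 2) ℂ := !![u, u * u; -1, -u] with hP₁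
  have hP1sq : P₁ * P₁ = 0 := by
    ext i j
    fin_cases i <;> fin_cases j <;> simp [hP₁, mul_assoc]
  have hP1j : (L j * P₁).trace = 0 := by
    rw [Matrix.eta_fin_two (L j), hP₁, Matrix.mul_fin_two, Matrix.trace_fin_two_of]
    linear_combination hu
  have hrel1 : ∑ i, ((L i * P₁).trace) ^ 2 • L i = 0 := by rw [← hsq P₁, hP1sq]
  -- Step 8: independence forces `tr(Lᵢ P₁) = 0` for all `i`, hence `P₁ = 0`: contradiction.
  have hzero : ∀ i, (L i * P₁).trace = 0 := by
    have hsum : ∑ i ∈ Finset.univ.erase j, ((L i * P₁).trace) ^ 2 • L i = 0 := by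
      rw [← Finset.add_sum_erase _ _ (Finset.mem_univ j), hP1j] at hrel1
      simpa using hrel1
    have hsum' : ∑ i : {i : Fin r // i ≠ j}, ((L i * P₁).trace) ^ 2 • L' i = 0 := by
      rw [← hsum]
      exact (Finset.sum_subtype _ (fun i => by simp [Finset.mem_erase])
        (fun i => ((L i * P₁).trace) ^ 2 • L i)).symm
    have hli' := Fintype.linearIndependent_iff.mp hli (fun i => ((L i * P₁).trace) ^ 2) hsum'
    intro i
    by_cases hij : i = j
    · rw [hij]; exact hP1j
    · exact pow_eq_zero_iff (n := 2) (by norm_num) |>.mp (hli' ⟨i, hij⟩)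
  have hP1 := hperp P₁ hzero
  have h10 := congrFun (congrFun hP1 1) 0
  simp [hP₁] at h10

/-- `6 ≤ R_S(sM⟨2⟩)`: the lower bound of Chiantini et al. 2018, Thm. 1.3(1), in terms of
`waringRankTrCube` (the defining set contains `6` and all its elements are `≥ 6`).
[cite: LandsbergTeitler2010, Cor. 6.8 (via Thm. 1.3)] -/
theorem six_le_waringRankTrCube_two : 6 ≤ waringRankTrCube 2 := by
  obtain ⟨L, hL⟩ := trCube_two_waringDecomposition
  exact le_csInf ⟨6, L, hL⟩ fun r ⟨L', hL'⟩ => six_le_of_waringDecomposition_trCube_two L' hL'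

/-! ## The named fact -/

/-- **DISCHARGE of `CHILO2018_waringRank_two`**: `R_S(sM⟨2⟩) = 6`, i.e. `waringRankTrCube 2 = 6`
(Chiantini et al. 2018, Thm. 1.3(1), "`R_S(sM⟨2⟩) = 6` ([Seg], [LT])"): `≤ 6` by the printed
decomposition (2.2) (`waringRankTrCube_two_le`), `≥ 6` by the Landsberg–Teitler singular-locus
bound (`six_le_waringRankTrCube_two`).
[cite: ChiantiniHauensteinIkenmeyerLandsbergOttaviani2018, Thm. 1.3(1)] -/
theorem CHILO2018_waringRank_two_holds : CHILO2018_waringRank_two :=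
  le_antisymm waringRankTrCube_two_le six_le_waringRankTrCube_two

end Literature.Computability.AlgebraicComplexity

end
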